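import Mathlib
import Summits.Ventures.HodgeRepro.Tier4.Common.AdelicDefs
import Summits.Ventures.HodgeRepro.Tier4.Line1.NormOneTorusAlgebra
import Summits.Ventures.HodgeRepro.Tier4.Line1.C7Components

/-!
# Tier4/Line4/HasseNormPrinciple — the Hasse norm theorem for the quadratic extension `k(√−d)/k`, TYPED in the
tree's vocabulary (the displayed hypothesis `hHasse` of L4's W5 (a) Hasse isolation; stated, NOT proved)

Blind re-derivation cell `pub-hodge-repro`, Tier 4 (README §9–§10), seat t4-L1-p5 (prover, LINE L1, gen 2; the lead's
cut S13359 for LINE L4's W5 (a), shape adjudicated by t4-plan-4).  The tree has no `E′ = k(√−d)` as a field; «`a ∈ k`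
is a norm from `k_v(√−d)`» is the polynomial statement `a = x² + d y²` over the completion `k_v` (split places
included, where it is vacuous), and «`a` is a norm from `E′ ⊗ 𝔸_k`» is `a = x² + d y²` on pairs of adeles
(`qnorm (ι d)` of `NormOneTorusAlgebra`).  Two displayed Props: `HasseNormPrinciple k d`, the ELEMENT-WISE theorem
as printed — Cassels, *Local Fields*, «Diophantine equations», Theorem B (Hasse) (statement; t4-lit-4 row 24);
Tate, «Global class field theory», Cassels–Fröhlich Ch. VII §9.6 (proof; t4-lit-1 row 51); Childress, *Class Field
Theory*, end of Ch. 5, «Hasse's norm principle» (proof, with the idelic form; t4-lit-4 row E9) — and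
`HasseNormPrincipleAdelic k d`, the IDELIC form `k^× ∩ N(𝔸_{E′}^×) = N(E′^×)` that the isolation argument consumes;
the kernel-checked `hasseNormPrincipleAdelic_of` derives the second from the first (the components of an adelic
solution at every place are local solutions).  NOTHING is asserted about the truth of either Prop in this module.

Nothing here says anything about the status of the Hodge conjecture for CM abelian varieties, which is NOT proved
(HC_CM is NOT proved by anyone in this repository).
-/

set_option autoImplicit false

noncomputable section

namespace Summit.Ventures.HodgeRepro.Tier4.Line4

open Summit.Ventures.HodgeRepro.Tier4.Common Summit.Ventures.HodgeRepro.Tier4.Line1 NumberField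
  IsDedekindDomain

section Hasse

variable (k : Type) [Field k] [NumberField k]

/-- **THE HASSE NORM THEOREM for `k(√−d)/k`, element-wise (the printed form; DISPLAYED, not proved)**: a non-zero
`a ∈ k` that is a norm `x² + d y²` from `k_v(√−d)` at every finite place `v` and from `k_w(√−d)` at every infinite
place `w` is a global norm `x² + d y²` with `x, y ∈ k`.  [Cassels, Local Fields, Thm B (Hasse); Tate, C–F VII §9.6;
Childress, CFT Ch. 5 «Hasse's norm principle».]  For `−d` a square the statement is trivially true (every `a` is a
norm); for `d = 0` it is false in general — a consumer supplies `¬ IsSquare (−d)` (hence `d ≠ 0`) from `IsGenuineRow`. -/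
def HasseNormPrinciple (d : k) : Prop :=
  ∀ a : k, a ≠ 0 →
    (∀ v : HeightOneSpectrum (𝓞 k), ∃ x y : v.adicCompletion k,
      algebraMap k (v.adicCompletion k) a =
        x * x + algebraMap k (v.adicCompletion k) d * (y * y)) →
    (∀ w : InfinitePlace k, ∃ x y : w.Completion,
      algebraMap k w.Completion a = x * x + algebraMap k w.Completion d * (y * y)) →
    ∃ x y : k, a = x * x + d * (y * y)

/-- **THE IDELIC FORM** (`k^× ∩ N(𝔸_{E′}^×) = N(E′^×)`; Childress Ch. 5; DISPLAYED): a non-zero `a ∈ k` that is the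
norm `qnorm (ι d) z = z₀² + d z₁²` of a pair of adeles is the norm of a rational pair. -/
def HasseNormPrincipleAdelic (d : k) : Prop :=
  ∀ a : k, a ≠ 0 →
    (∃ z : Fin 2 → Ad k, qnorm (algebraMap k (Ad k) d) z = algebraMap k (Ad k) a) →
    ∃ γ : Fin 2 → k, qnorm d γ = a

variable {k}

/-- the finite component of a rational adele is the rational element in the completion -/
theorem finHom_algebraMap (v : HeightOneSpectrum (𝓞 k)) (a : k) :
    finHom (k := k) v (algebraMap k (Ad k) a) = algebraMap k (v.adicCompletion k) a := by
  have h := congrFun (finVec_algebraMap (k := k) v (fun _ => a)) 0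
  simpa [finVec, finRat, finHom_apply] using h

/-- the infinite component of a rational adele is the rational element in the completion -/
theorem infHom_algebraMap (w : InfinitePlace k) (a : k) :
    infHom (k := k) w (algebraMap k (Ad k) a) = algebraMap k w.Completion a :=
  congrFun (infVec_algebraMap (k := k) w (fun _ => a)) 0

/-- **the idelic form follows from the printed one** (kernel-checked): the components of an adelic solution
`z₀² + d z₁² = a` at every place are local solutions. -/
theorem hasseNormPrincipleAdelic_of {d : k} (h : HasseNormPrinciple k d) : HasseNormPrincipleAdelic k d := by
  intro a ha hz
  obtain ⟨z, hz⟩ := hz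
  suffices hxy : ∃ x y : k, a = x * x + d * (y * y) by
    obtain ⟨x, y, hxy⟩ := hxy
    refine ⟨![x, y], ?_⟩
    simp [qnorm]
    exact hxy.symm
  refine h a ha ?_ ?_
  · intro v
    refine ⟨finHom (k := k) v (z 0), finHom (k := k) v (z 1), ?_⟩
    have := congrArg (finHom (k := k) v) hz
    simp only [qnorm, map_add, map_mul, finHom_algebraMap] at this
    exact this.symm
  · intro w
    refine ⟨infHom (k := k) w (z 0), infHom (k := k) w (z 1), ?_⟩
    have := congrArg (infHom (k := k) w) hz
    simp only [qnorm, map_add, map_mul, infHom_algebraMap] at this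
    exact this.symm

/-- the split junk test: if `−d` is a non-zero square, every `a` is a global norm (`x² + d y² = (x − cy)(x + cy)`), so
the printed Prop holds trivially — the content of the Prop is the non-split case. -/
theorem hasseNormPrinciple_of_isSquare {d : k} (hd0 : d ≠ 0) (hd : IsSquare (-d)) : HasseNormPrinciple k d := by
  intro a _ _ _
  obtain ⟨c, hc⟩ := hd
  have hc0 : c ≠ 0 := by
    rintro rfl
    apply hd0
    have : -d = 0 := by rw [hc]; ring
    exact neg_eq_zero.mp this
  refine ⟨(a + 1) / 2, (1 - a) / (2 * c), ?_⟩
  have hd' : d = -(c * c) := by rw [← hc]; ring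
  rw [hd']
  field_simp
  ring

end Hasse

end Summit.Ventures.HodgeRepro.Tier4.Line4

end
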